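import Literature.Analysis.FluidPDE.TaoAnnulusAssembly
import Literature.Analysis.FluidPDE.TaoBoundedTotalSpeedProofs
import HarnessLib

/-!
# Tao (2011), Cor. 11.4: unconditional uniqueness reduced to the single nonlinear estimate `Y₆`

Analysis/FluidPDE. With the §9 leaf `NS.tao2011_duhamelNonlinearSpeed_unit` now PROVED in the
tree (`tao2011_duhamelNonlinearSpeed_unit_holds`, `TaoBoundedTotalSpeedProofs.lean`: Tao 2011,
Prop. 9.1, the nonlinear Duhamel component) and the §10 assembly of `TaoAnnulusAssembly.lean`
(`tao_unconditional_uniqueness_velocity_of_nonlinearEstimate_of_duhamel`), every statement of the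
uniqueness chain of arXiv:1108.1165 — Thm. 10.1 (bounded enstrophy on balls), Cor. 11.1 and
Cor. 11.4 (`NS.tao_unconditional_uniqueness_velocity`, `NS.tao_unconditional_uniqueness`,
`NS.tao_finite_energy_velocity_uniqueness`) — now follows from exactly ONE remaining named fact,
the nonlinear estimate `NS.tao2011_nonlinearEstimate` (Tao's `Y₆` bound, proof of Thm. 10.1,
(10.19)–(10.23)). This file records these one-hypothesis reductions; when
`tao2011_nonlinearEstimate` is discharged, `tao_unconditional_uniqueness_velocity_holds` is the
term `tao_unconditional_uniqueness_velocity_of_nonlinearEstimate tao2011_nonlinearEstimate_holds`.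

## References

* T. Tao, *Localisation and compactness properties of the Navier–Stokes global regularity
  problem*, Anal. PDE 6 (2013) = arXiv:1108.1165 (`Tao2011`), Prop. 9.1, Thm. 10.1, Cor. 11.1,
  Cor. 11.4, Remark 11.5.
-/

noncomputable section

namespace Literature.Analysis.FluidPDE

/-- **Bounded enstrophy (Tao 2011, Thm. 10.1 ⇒ Cor. 11.1 input) from `Y₆` alone**: the §9 speed
leaf is supplied by the tree's `tao2011_duhamelNonlinearSpeed_unit_holds`. [cite: Tao2011, Thm. 10.1 + Prop. 9.1] -/
theorem tao2011_boundedEnstrophy_of_nonlinearEstimate (hY : tao2011_nonlinearEstimate) :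
    tao2011_boundedEnstrophy :=
  tao2011_boundedEnstrophy_of_nonlinearEstimate_of_duhamel hY tao2011_duhamelNonlinearSpeed_unit_holds

/-- **Tao 2011, Cor. 11.4 (all three forms) from `Y₆` alone.** [cite: Tao2011, Cor. 11.4 + Cor. 11.1 + Thm. 10.1 + Prop. 9.1] -/
theorem tao_unconditional_uniqueness_of_nonlinearEstimate (hY : tao2011_nonlinearEstimate) :
    tao_unconditional_uniqueness ∧ tao_unconditional_uniqueness_velocity ∧
      tao_finite_energy_velocity_uniqueness :=
  tao_unconditional_uniqueness_of_nonlinear_duhamel_leaves hY tao2011_duhamelNonlinearSpeed_unit_holds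

/-- **Tao 2011, Cor. 11.4, velocity form, from `Y₆` alone**: unconditional uniqueness of finite
energy classical solutions with `H¹` data on `[0, T] × ℝ³` follows from the single remaining named
fact `tao2011_nonlinearEstimate`. [cite: Tao2011, Cor. 11.4] -/
theorem tao_unconditional_uniqueness_velocity_of_nonlinearEstimate (hY : tao2011_nonlinearEstimate) :
    tao_unconditional_uniqueness_velocity :=
  (tao_unconditional_uniqueness_of_nonlinearEstimate hY).2.1

end Literature.Analysis.FluidPDE

end
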